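import Summits.Ventures.WeilGRH.FlatWindowSpectral
import Summits.Ventures.WeilGRH.ZetaFlatTest
import Summits.Ventures.WeilGRH.FlatWindowConstantsCentral
import Literature.NumberTheory.LFunctions.WeilBochnerRepresentationRH
import Literature.NumberTheory.LFunctions.ZetaZeroReciprocalSum
import Literature.NumberTheory.LFunctions.ZetaQuotientKernelTheorem
import HarnessLib

/-!
# rh-explicit (venture WeilGRH): the `ζ` FLAT-WINDOW IDENTITY — the `ζ`-rung inequality is sharp to
  `O(1/a)`; under RH `2Σ_{n<x}Λ(n)n^{-1/2}(1 − log n/log x) = 8(√x − 2 + x^{-1/2})/log x − 2ζ′(½)/ζ(½) + O(1/log x)`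

Cell `rh-explicit`, WEIL TRACK (structure seat weil-3, gen9).  The `ζ` twin of `FlatWindowSpectral.lean`,
built on the structure seat's `WeilBochnerMeasureWindow.weilWindowForm_eq_integral` (gen4: a `ζ`-window
measure represents the window form on window functions; the growth law makes `(1+t²)⁻¹ ∈ L¹(μ)` automatic)
and `ZetaFlatTest.weilWindowForm_chi_zero` (gen7: the window form of the flat window in closed form).

* **`zetaFlatWindow_eq_pole_sub_integral`** (RH-free): for every measure `μ` representing Weil's form on
  the tests of `[-a, a]`,
  `2Σ_{log n<2a}Λ(n)n^{-1/2}(1 − log n/(2a)) + K₀ − I₀(a)/a = 16 sinh²(a/2)/a − ∫ 2sin²(at)/(at²) dμ(t)` —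
  Yoshida's Gram entry `G(0,0)` IS the Fejér integral of the spectral measure;
* **`zetaFlatWindow_sandwich`**, `abs_zetaFlatSum_add_atom_sub_le` (RH-free, any such `μ` with
  `t⁻² ∈ L¹(μ)`): `|2S(a) + 2a·μ{0} − (16 sinh²(a/2)/a − K₀)| ≤ (5 + 2∫t⁻²dμ)/a`;
* `integrable_inv_sq_zetaZeroHeightMeasure` (unconditional), `zetaZeroHeightMeasure_singleton_zero_of_riemannHypothesis`
  (RH ⟹ no atom at the centre, `ζ(½) ≠ 0`);
* **`zetaFlatSum_sandwich_of_riemannHypothesis`**, **`exists_abs_zetaFlatSum_sub_le_of_riemannHypothesis`**: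
  RH ⟹ for every `a > 0`,
  `16 sinh²(a/2)/a − 2ζ′(½)/ζ(½) + I₀(a)/a − (2/a)Σ_ρ m(ρ)/γ² ≤ 2S(a) ≤ 16 sinh²(a/2)/a − 2ζ′(½)/ζ(½) + I₀(a)/a`
  (`K₀ = 2ζ′(½)/ζ(½)`, `FlatWindowConstantsCentral`); numerically `2Σ_ρ m(ρ)/γ² = 0.0924`, so the `ζ`
  flat-window inequality (a theorem RH-free for `a ≤ 4023/5000`) is an equality to within `0.093/a` at every
  window under RH (observed slack·a ∈ [0.029, 0.067] for `a ≤ 6`, structure seat tools/flatasym.py).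

No definitions, no named facts; RH is a hypothesis where named.

## References

* H. Yoshida, *On Hermitian forms attached to zeta functions*, Adv. Stud. Pure Math. 21 (1992) 281–325,
  (5.15)/(5.16) (`G(0,0)`). [Yoshida1992]
* E. Bombieri, *Remarks on Weil's quadratic functional in the theory of prime numbers I*, Rend. Mat. Acc.
  Lincei (9) 11 (2000) 183–233, Thm. 2 / §3 (3.2) (the explicit formula, zero side). [Bombieri2000Weil]
-/

set_option autoImplicit false

noncomputable section

open Complex Filter Set MeasureTheory
open scoped Real Topology ComplexConjugate ArithmeticFunction.vonMangoldt

namespace Summit.Ventures.WeilGRH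

open Literature.NumberTheory.LFunctions
open Literature.NumberTheory.LFunctions.Yoshida1992 (chi chiCore contDiff_chiCore)
open Summit.RiemannHypothesis.RiemannHypothesis.Theorems.WeilFormatC
open Summit.RiemannHypothesis.RiemannHypothesis.Theorems.WeilBochnerMeasure

variable {a : ℝ}

/-! ## The `ζ` flat-window identity at the measure level -/

/-- **THE `ζ` FLAT-WINDOW IDENTITY (measure level, RH-free).**  Let `a > 0` and let `μ` represent Weil's
form on the tests of `[-a, a]` (such `μ` exist iff `WeilPositivityOn a`; unconditionally for
`a ≤ 4023/5000`).  Then `‖χ̂_0(½+it)‖² = 2sin²(at)/(at²) ∈ L¹(μ)` and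

  `2Σ_{log n<2a} Λ(n)n^{-1/2}(1 − log n/(2a)) + K₀ − I₀(a)/a = 16 sinh²(a/2)/a − ∫ ‖χ̂_0(½+it)‖² dμ(t)`

(`K₀ = log 4π + γ + 2∫₀^∞(e^{t/2} − 1)dt/(2 sinh t) = log 8π + γ + π/2`, `I₀(a) = ∫₀^∞ρ₀(t)min(t,2a)dt`):
the `ζ` flat-window INEQUALITY of `ZetaFlatTest.lean` (`… ≤ 16 sinh²(a/2)/a`, Yoshida's `G(0,0) ≥ 0`)
with its slack — the Gram entry `G(0,0)` — written as the Fejér integral of the spectral measure. -/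
theorem zetaFlatWindow_eq_pole_sub_integral (ha : 0 < a) {μ : Measure ℝ}
    (hμ : ∀ g : ℝ → ℂ, IsWeilTest g → tsupport g ⊆ Icc (-a) a →
      Integrable (fun t : ℝ ↦ ‖weilMellin g (1 / 2 + t * I)‖ ^ 2) μ ∧
        weilQuadratic g = ((∫ t, ‖weilMellin g (1 / 2 + t * I)‖ ^ 2 ∂μ : ℝ) : ℂ)) :
    Integrable (fun t : ℝ ↦ ‖weilMellin (chi a 0) (1 / 2 + t * I)‖ ^ 2) μ ∧
      2 * (∑ n ∈ weilPrimeIndex a, (Λ n : ℝ) / Real.sqrt n * (1 - Real.log n / (2 * a))) +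
          (Real.log (4 * π) + Real.eulerMascheroniConstant +
            2 * ∫ t in Ioi (0 : ℝ), weilKillingDensityPar 0 t) -
          1 / a * (∫ t in Ioi (0 : ℝ), weilArchDensityPar 0 t * min t (2 * a)) =
        16 * Real.sinh (a / 2) ^ 2 / a - ∫ t, ‖weilMellin (chi a 0) (1 / 2 + t * I)‖ ^ 2 ∂μ := by
  obtain ⟨hint, heq⟩ := weilWindowForm_eq_integral ha hμ (isWindowFunction_chi ha 0)
    (contDiff_chiCore a 0) (fun x hx ↦ chi_eq_chiCore_of_mem 0 hx)
  rw [weilWindowForm_chi_zero ha,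
    show (fun t ↦ (Real.exp (t / 2) - 1) / (2 * Real.sinh t)) = fun t ↦ weilKillingDensityPar 0 t from
      (funext weilKillingDensityPar_zero_eq).symm,
    show (fun t ↦ weilArchDensity t * min t (2 * a)) = fun t ↦ weilArchDensityPar 0 t * min t (2 * a) from
      funext fun t ↦ by rw [weilArchDensityPar_zero_apply]] at heq
  exact ⟨hint, by linarith⟩

/-- **THE `ζ` SANDWICH (measure level, RH-free).**  With `m₀ = μ{0}`, `M₂ = ∫ t⁻² dμ` (finite by
hypothesis; `(1+t²)⁻¹ ∈ L¹(μ)` is automatic, `WeilBochnerMeasureGrowth`):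
`16 sinh²(a/2)/a − K₀ + I₀(a)/a − 2a·m₀ − (2/a)M₂ ≤ 2S(a) ≤ 16 sinh²(a/2)/a − K₀ + I₀(a)/a − 2a·m₀`. -/
theorem zetaFlatWindow_sandwich (ha : 0 < a) {μ : Measure ℝ}
    (hμ : ∀ g : ℝ → ℂ, IsWeilTest g → tsupport g ⊆ Icc (-a) a →
      Integrable (fun t : ℝ ↦ ‖weilMellin g (1 / 2 + t * I)‖ ^ 2) μ ∧
        weilQuadratic g = ((∫ t, ‖weilMellin g (1 / 2 + t * I)‖ ^ 2 ∂μ : ℝ) : ℂ))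
    (hM : Integrable (fun t : ℝ ↦ (t ^ 2)⁻¹) μ) :
    16 * Real.sinh (a / 2) ^ 2 / a -
          (Real.log (4 * π) + Real.eulerMascheroniConstant +
            2 * ∫ t in Ioi (0 : ℝ), weilKillingDensityPar 0 t) +
          1 / a * (∫ t in Ioi (0 : ℝ), weilArchDensityPar 0 t * min t (2 * a)) -
          2 * a * μ.real {0} - 2 / a * ∫ t, (t ^ 2)⁻¹ ∂μ ≤
        2 * (∑ n ∈ weilPrimeIndex a, (Λ n : ℝ) / Real.sqrt n * (1 - Real.log n / (2 * a))) ∧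
      2 * (∑ n ∈ weilPrimeIndex a, (Λ n : ℝ) / Real.sqrt n * (1 - Real.log n / (2 * a))) ≤
        16 * Real.sinh (a / 2) ^ 2 / a -
          (Real.log (4 * π) + Real.eulerMascheroniConstant +
            2 * ∫ t in Ioi (0 : ℝ), weilKillingDensityPar 0 t) +
          1 / a * (∫ t in Ioi (0 : ℝ), weilArchDensityPar 0 t * min t (2 * a)) -
          2 * a * μ.real {0} := by
  obtain ⟨hint, heq⟩ := zetaFlatWindow_eq_pole_sub_integral ha hμ
  have h0 := measure_zero_lt_top_of_integrable (integrable_inv_one_add_sq ha hμ)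
  have hlo := two_mul_mul_measureReal_zero_le_integral ha hint h0
  have hhi := integral_norm_sq_weilMellin_chi_zero_le ha hint h0 hM
  constructor <;> linarith

/-- **`|2S(a) + 2a·μ{0} − (16 sinh²(a/2)/a − K₀)| ≤ (5 + 2M₂)/a`** for every `ζ`-window measure with a
finite second inverse moment. -/
theorem abs_zetaFlatSum_add_atom_sub_le (ha : 0 < a) {μ : Measure ℝ}
    (hμ : ∀ g : ℝ → ℂ, IsWeilTest g → tsupport g ⊆ Icc (-a) a →
      Integrable (fun t : ℝ ↦ ‖weilMellin g (1 / 2 + t * I)‖ ^ 2) μ ∧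
        weilQuadratic g = ((∫ t, ‖weilMellin g (1 / 2 + t * I)‖ ^ 2 ∂μ : ℝ) : ℂ))
    (hM : Integrable (fun t : ℝ ↦ (t ^ 2)⁻¹) μ) :
    |2 * (∑ n ∈ weilPrimeIndex a, (Λ n : ℝ) / Real.sqrt n * (1 - Real.log n / (2 * a))) +
        2 * a * μ.real {0} -
        (16 * Real.sinh (a / 2) ^ 2 / a - (Real.log (4 * π) + Real.eulerMascheroniConstant +
            2 * ∫ t in Ioi (0 : ℝ), weilKillingDensityPar 0 t))| ≤
      (5 + 2 * ∫ t, (t ^ 2)⁻¹ ∂μ) / a := by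
  obtain ⟨hlo, hhi⟩ := zetaFlatWindow_sandwich ha hμ hM
  have hI5 := integral_weilArchDensityPar_mul_min_le_five 0 ha.le
  have hI0 := integral_weilArchDensityPar_mul_min_nonneg 0 ha.le
  have hM0 : 0 ≤ ∫ t, (t ^ 2)⁻¹ ∂μ := integral_nonneg fun t ↦ by positivity
  set Iκ := ∫ t in Ioi (0 : ℝ), weilArchDensityPar 0 t * min t (2 * a) with hIκ
  set M₂ := ∫ t, (t ^ 2)⁻¹ ∂μ with hM₂
  have e1 : 1 / a * Iκ ≤ 5 / a := by
    rw [one_div_mul_eq_div]; exact div_le_div_of_nonneg_right hI5 ha.le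
  have e2 : 0 ≤ 1 / a * Iκ := by positivity
  have e3 : (5 + 2 * M₂) / a = 5 / a + 2 / a * M₂ := by field_simp
  rw [abs_le, e3]
  constructor <;> linarith

/-! ## Under RH: the zero-height measure of `ζ` has no atom at the centre and a finite `∫ t⁻²` -/

open Literature.NumberTheory.LFunctions.WeilBochner (zetaZeroHeightMeasure lintegral_zetaZeroHeightMeasure)
open Literature.NumberTheory.LFunctions.ZetaZeros (riemannZetaNontrivialZeros)

/-- `∫ f dν < ∞` for `f ≥ 0` measurable with `Σ_ρ m(ρ) f(Im ρ) < ∞` (`ν` the zero-height measure of `ζ`). -/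
theorem integrable_zetaZeroHeightMeasure_of_summable {f : ℝ → ℝ} (hfm : Measurable f)
    (hf0 : ∀ t, 0 ≤ f t)
    (hsum : Summable fun ρ : riemannZetaNontrivialZeros ↦
      ((riemannZetaZeroOrder (ρ : ℂ)).toNat : ℝ) * f (ρ : ℂ).im) :
    Integrable f zetaZeroHeightMeasure := by
  refine ⟨hfm.aestronglyMeasurable, ?_⟩
  rw [hasFiniteIntegral_iff_ofReal (ae_of_all _ hf0), lintegral_zetaZeroHeightMeasure hfm.ennreal_ofReal]
  have hterm : ∀ ρ : riemannZetaNontrivialZeros,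
      ((riemannZetaZeroOrder (ρ : ℂ)).toNat : ENNReal) * ENNReal.ofReal (f (ρ : ℂ).im) =
        ENNReal.ofReal (((riemannZetaZeroOrder (ρ : ℂ)).toNat : ℝ) * f (ρ : ℂ).im) := fun ρ ↦ by
    rw [ENNReal.ofReal_mul (Nat.cast_nonneg _), ENNReal.ofReal_natCast]
  simp_rw [hterm]
  rw [← ENNReal.ofReal_tsum_of_nonneg (fun ρ ↦ mul_nonneg (Nat.cast_nonneg _) (hf0 _)) hsum]
  exact ENNReal.ofReal_lt_top

/-- The multiplicity as a natural number is the (non-negative) integer order. -/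
theorem toNat_riemannZetaZeroOrder_cast (ρ : riemannZetaNontrivialZeros) :
    (((riemannZetaZeroOrder (ρ : ℂ)).toNat : ℕ) : ℝ) = (riemannZetaZeroOrder (ρ : ℂ) : ℝ) := by
  have h0 : 0 ≤ riemannZetaZeroOrder (ρ : ℂ) :=
    riemannZetaZeroOrder_nonneg (ZetaZeros.riemannZetaNontrivialZeros.ne_one ρ.2)
  exact_mod_cast Int.toNat_of_nonneg h0

/-- **`t⁻² ∈ L¹(ν)`** for the zero-height measure of `ζ` (unconditional): off the finitely many zeros
with `|Im ρ| ≤ 1` (`weilZeroFinset 1`) one has `γ⁻² ≤ 2(1+γ²)⁻¹`, and `Σ_ρ m(ρ)/(1+γ²) < ∞`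
(`ZetaZeroSum.summable_zeroOrder_div_one_add_sq`). -/
theorem integrable_inv_sq_zetaZeroHeightMeasure :
    Integrable (fun t : ℝ ↦ (t ^ 2)⁻¹) zetaZeroHeightMeasure := by
  have hmeas : Measurable fun t : ℝ ↦ (t ^ 2)⁻¹ := (measurable_id.pow_const 2).inv
  refine integrable_zetaZeroHeightMeasure_of_summable hmeas (fun t ↦ by positivity) ?_
  have hg : Summable fun ρ : riemannZetaNontrivialZeros ↦
      2 * ((riemannZetaZeroOrder (ρ : ℂ) : ℝ) / (1 + (ρ : ℂ).im ^ 2)) :=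
    ZetaZeroSum.summable_zeroOrder_div_one_add_sq.mul_left 2
  refine Summable.of_norm_bounded_eventually hg ?_
  filter_upwards [(weilZeroFinset 1).eventually_cofinite_notMem] with ρ hρ
  rw [mem_weilZeroFinset, not_le] at hρ
  rw [toNat_riemannZetaZeroOrder_cast]
  have hm0 : (0 : ℝ) ≤ riemannZetaZeroOrder (ρ : ℂ) := by
    exact_mod_cast riemannZetaZeroOrder_nonneg (ZetaZeros.riemannZetaNontrivialZeros.ne_one ρ.2)
  rw [Real.norm_of_nonneg (mul_nonneg hm0 (by positivity))]
  have h1 : 1 < (ρ : ℂ).im ^ 2 := by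
    have := sq_lt_sq' (by linarith [abs_nonneg ((ρ : ℂ).im)]) hρ
    simpa [sq_abs] using this
  have h2 : ((ρ : ℂ).im ^ 2)⁻¹ ≤ 2 / (1 + (ρ : ℂ).im ^ 2) := by
    rw [inv_eq_one_div, div_le_div_iff₀ (by positivity) (by positivity)]
    linarith
  calc (riemannZetaZeroOrder (ρ : ℂ) : ℝ) * ((ρ : ℂ).im ^ 2)⁻¹
      ≤ (riemannZetaZeroOrder (ρ : ℂ) : ℝ) * (2 / (1 + (ρ : ℂ).im ^ 2)) := mul_le_mul_of_nonneg_left h2 hm0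
    _ = 2 * ((riemannZetaZeroOrder (ρ : ℂ) : ℝ) / (1 + (ρ : ℂ).im ^ 2)) := by ring

/-- **Under RH the zero-height measure of `ζ` has no atom at the centre** (`ζ(½) ≠ 0`,
`riemannZeta_one_half_ne_zero`): `ν{0} = 0`. -/
theorem zetaZeroHeightMeasure_singleton_zero_of_riemannHypothesis (hRH : RiemannHypothesis) :
    zetaZeroHeightMeasure {0} = 0 := by
  rw [zetaZeroHeightMeasure, Measure.sum_apply _ (measurableSet_singleton 0)]
  simp only [Measure.smul_apply, smul_eq_mul]
  refine ENNReal.tsum_eq_zero.2 fun ρ ↦ ?_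
  have him : (ρ : ℂ).im ≠ 0 := by
    intro him
    have hρ := ρ.2
    have hre : (ρ : ℂ).re = 1 / 2 := by
      refine hRH _ (ZetaZeros.riemannZetaNontrivialZeros.zeta_eq_zero hρ) ?_
        (ZetaZeros.riemannZetaNontrivialZeros.ne_one hρ)
      rintro ⟨n, hn⟩
      have h0 := ZetaZeros.riemannZetaNontrivialZeros.re_pos hρ
      have e : (-2 * ((n : ℂ) + 1)).re = -2 * ((n : ℝ) + 1) := by simp
      rw [hn, e] at h0
      have : (0 : ℝ) ≤ n := n.cast_nonneg
      linarith
    have hhalf : (ρ : ℂ) = 1 / 2 := by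
      apply Complex.ext <;> simp [hre, him]
    exact riemannZeta_one_half_ne_zero (hhalf ▸ ZetaZeros.riemannZetaNontrivialZeros.zeta_eq_zero hρ)
  rw [Measure.dirac_apply' _ (measurableSet_singleton 0), indicator_of_notMem (by simpa using him), mul_zero]

/-! ## Under RH: the `ζ` flat-window inequality is sharp to `O(1/a)` at EVERY window -/

/-- **RH ⟹ THE `ζ` FLAT WINDOW IS ASYMPTOTICALLY EXTREMAL.**  If the Riemann hypothesis holds then, with
`C = 2Σ_ρ m(ρ)/γ²` (over all non-trivial zeros, both signs of `γ`), for every `a > 0`: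

  `16 sinh²(a/2)/a − 2ζ′(½)/ζ(½) + I₀(a)/a − C/a ≤ 2Σ_{log n<2a} Λ(n)n^{-1/2}(1 − log n/(2a))`
  `≤ 16 sinh²(a/2)/a − 2ζ′(½)/ζ(½) + I₀(a)/a`

(`K₀ = 2ζ′(½)/ζ(½)`, `FlatWindowConstantsCentral`; the right inequality is the rung,
`ZetaFlatTest.zetaFlatWindow_le_of_riemannHypothesis`; the left one is the explicit formula).  In the
variable `x = e^{2a}`: `2Σ_{n<x}Λ(n)n^{-1/2}(1 − log n/log x) = 8(√x − 2 + x^{-1/2})/log x − 2ζ′(½)/ζ(½) + O(1/log x)`. -/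
theorem zetaFlatSum_sandwich_of_riemannHypothesis (hRH : RiemannHypothesis) (ha : 0 < a) :
    16 * Real.sinh (a / 2) ^ 2 / a - 2 * (deriv riemannZeta (1 / 2) / riemannZeta (1 / 2)).re +
          1 / a * (∫ t in Ioi (0 : ℝ), weilArchDensityPar 0 t * min t (2 * a)) -
          2 / a * ∫ t, (t ^ 2)⁻¹ ∂zetaZeroHeightMeasure ≤
        2 * (∑ n ∈ weilPrimeIndex a, (Λ n : ℝ) / Real.sqrt n * (1 - Real.log n / (2 * a))) ∧
      2 * (∑ n ∈ weilPrimeIndex a, (Λ n : ℝ) / Real.sqrt n * (1 - Real.log n / (2 * a))) ≤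
        16 * Real.sinh (a / 2) ^ 2 / a - 2 * (deriv riemannZeta (1 / 2) / riemannZeta (1 / 2)).re +
          1 / a * (∫ t in Ioi (0 : ℝ), weilArchDensityPar 0 t * min t (2 * a)) := by
  obtain ⟨hlo, hhi⟩ := zetaFlatWindow_sandwich ha
    (fun g hg _ ↦ WeilBochner.weilQuadratic_eq_integral_of_riemannHypothesis hRH hg)
    integrable_inv_sq_zetaZeroHeightMeasure
  have hm : zetaZeroHeightMeasure.real {0} = 0 := by
    rw [measureReal_def, zetaZeroHeightMeasure_singleton_zero_of_riemannHypothesis hRH, ENNReal.toReal_zero]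
  have hK : Real.log (4 * π) + Real.eulerMascheroniConstant + 2 * ∫ t in Ioi (0 : ℝ), weilKillingDensityPar 0 t =
      2 * (deriv riemannZeta (1 / 2) / riemannZeta (1 / 2)).re := by
    have h := congrArg Complex.re flatWindow_const_zero_eq_two_mul_logDeriv_zeta
    rw [Complex.ofReal_re] at h
    rw [h]
    simp [Complex.mul_re]
  rw [hm, hK] at hlo hhi
  constructor <;> linarith

/-- **RH ⟹ `|2Σ_{log n<2a}Λ(n)n^{-1/2}(1 − log n/(2a)) − 16 sinh²(a/2)/a + 2ζ′(½)/ζ(½)| ≤ C/a` for all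
`a > 0`**, `C = 5 + 2Σ_ρ m(ρ)/γ²`. -/
theorem exists_abs_zetaFlatSum_sub_le_of_riemannHypothesis (hRH : RiemannHypothesis) :
    ∃ C : ℝ, ∀ a : ℝ, 0 < a →
      |2 * (∑ n ∈ weilPrimeIndex a, (Λ n : ℝ) / Real.sqrt n * (1 - Real.log n / (2 * a))) -
          (16 * Real.sinh (a / 2) ^ 2 / a - 2 * (deriv riemannZeta (1 / 2) / riemannZeta (1 / 2)).re)| ≤
        C / a := by
  refine ⟨5 + 2 * ∫ t, (t ^ 2)⁻¹ ∂zetaZeroHeightMeasure, fun a ha ↦ ?_⟩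
  have h := abs_zetaFlatSum_add_atom_sub_le ha
    (fun g hg _ ↦ WeilBochner.weilQuadratic_eq_integral_of_riemannHypothesis hRH hg)
    integrable_inv_sq_zetaZeroHeightMeasure
  have hm : zetaZeroHeightMeasure.real {0} = 0 := by
    rw [measureReal_def, zetaZeroHeightMeasure_singleton_zero_of_riemannHypothesis hRH, ENNReal.toReal_zero]
  have hK : Real.log (4 * π) + Real.eulerMascheroniConstant + 2 * ∫ t in Ioi (0 : ℝ), weilKillingDensityPar 0 t =
      2 * (deriv riemannZeta (1 / 2) / riemannZeta (1 / 2)).re := by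
    have h := congrArg Complex.re flatWindow_const_zero_eq_two_mul_logDeriv_zeta
    rw [Complex.ofReal_re] at h
    rw [h]
    simp [Complex.mul_re]
  rw [hm, hK, mul_zero, add_zero] at h
  exact h

end Summit.Ventures.WeilGRH

end
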